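import Summits.NavierStokesRegularity.NavierStokesRegularity.Theorems.LerayQuarterDissipationFiniteDissipationLiouvillePersistenceSeq
import HarnessLib

/-!
# Crux `FiniteDissipationLiouville` (stmt-NavierStokesRegularity-22144): the CRITICAL ELEMENT —
# if the crux fails, a singular profile of LEAST dissipation exists, and its dimensionless
# dissipation nearly saturates its own bound on a relatively dense set of log-times

Theorems file of route `LerayQuarterDissipation` (seat ns-lqd-p1 g2; `--supports` the crux and its
child stmt-22508). Navier–Stokes regularity is NOT proved by anything here; no summit is.

`𝒟_{C,K}`: Type-I ancient mild fields in the KNSS gauge with constant `C` and the quarter-rate law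
`∫ ‖∇u(s)‖² ≤ K/√(−s)`; `D_u(t) = √(−t) ∫ ‖∇u(t)‖²` the dimensionless dissipation; "singular" =
unbounded on every backward cylinder at the origin (the negation of the crux's conclusion).

* `exists_singular_of_subthreshold_windows` — if a SINGULAR member of `𝒟_{C,K}` has `D ≤ K₁` on
  backward log-windows `[Λ²τ, τ/Λ²]` of unbounded length, then `𝒟_{C,K₁}` has a singular member too
  (orbit limit with the window constant, `…Subthreshold.exists_orbitLimit_of_eventually_law`, plus
  persistence, p1 g0);
* `exists_minimal_singular` — **the critical element**: if `𝒟_{C,K}` has a singular member, there is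
  a least constant `K_c ≤ K` for which `𝒟_{C,K_c}` has a singular member `W_c`; no member of any
  `𝒟_{C,K'}`, `K' < K_c`, is singular (`sInf`, compactness across members `…Compactness.seqLimit`,
  the law of the limit, persistence across members `…Compactness.persistent_singularity_seq`);
  `K₀ < K_c` for the absolute gap constant (`criticalConstant_gt_gap`);
* `dissipation_nearMax_of_minimal` — **near-saturation**: a singular member `W` of `𝒟_{C,K_c}` with
  `K_c` minimal has, for every `ε > 0`, a log-window length `Λ` such that EVERY backward window
  `[Λ²τ, τ/Λ²]` contains a time with `D_W(t) > K_c − ε` — while `D_W ≤ K_c` throughout. In words: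
  the critical element's dimensionless dissipation is almost maximal on a relatively dense set of
  log-times (the sub-threshold mechanism run at the critical level instead of the gap level);
* `criticalElement` — the package: FDL fails for the constant `C` iff (trivially "if") some
  `𝒟_{C,K}` has a singular member, and then a near-saturating critical element exists.

This is the Kenig–Merle-type structure of the stratum: any proof of the crux may assume a singular
profile of minimal dissipation whose dissipation nearly saturates everywhere in log-time; any
disproof must produce one.
-/

noncomputable section

-- the summit and its single sub-problem share the name (CONVENTIONS §1), as in every Theorems file
set_option linter.dupNamespace false

namespace Summit.NavierStokesRegularity.NavierStokesRegularity.Theorems.FiniteDissipationLiouville.CriticalElement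

open MeasureTheory Set Filter Topology Metric Function
open Literature.Analysis Literature.Analysis.FluidPDE
open scoped ENNReal NNReal

/-! ### Monotonicity of the law and windows ⇒ scales -/

/-- The dissipation law is monotone in its constant. -/
theorem law_mono {K K' : ℝ} (hKK' : K ≤ K')
    {u : ℝ → EuclideanSpace ℝ (Fin 3) → EuclideanSpace ℝ (Fin 3)}
    (hlaw : ∀ s : ℝ, s < 0 → ∫⁻ x, ‖fderiv ℝ (u s) x‖ₑ ^ 2 ≤ ENNReal.ofReal (K / Real.sqrt (-s))) :
    ∀ s : ℝ, s < 0 → ∫⁻ x, ‖fderiv ℝ (u s) x‖ₑ ^ 2 ≤ ENNReal.ofReal (K' / Real.sqrt (-s)) :=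
  fun s hs => (hlaw s hs).trans (ENNReal.ofReal_le_ofReal
    (div_le_div_of_nonneg_right hKK' (Real.sqrt_nonneg _)))

/-- **Windows of unbounded log-length give scales with eventual rescaled laws**: from windows
`[Λ²τ_Λ, τ_Λ/Λ²]` carrying `D_u ≤ K₁` (every `Λ > 1`) one gets scales `l_k > 0` such that for every
fixed `s < 0` the law `∫ ‖∇u(l_k² s)‖² ≤ K₁/√(−l_k² s)` holds for all large `k`
(`Λ_k = k+2`, `l_k = √(−τ_k)`). -/
theorem exists_scales_of_windows {K₁ : ℝ}
    {u : ℝ → EuclideanSpace ℝ (Fin 3) → EuclideanSpace ℝ (Fin 3)}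
    (hwin : ∀ Λ : ℝ, 1 < Λ → ∃ τ : ℝ, τ < 0 ∧ ∀ t ∈ Set.Icc (Λ ^ 2 * τ) (τ / Λ ^ 2),
      ∫⁻ x, ‖fderiv ℝ (u t) x‖ₑ ^ 2 ≤ ENNReal.ofReal (K₁ / Real.sqrt (-t))) :
    ∃ l : ℕ → ℝ, (∀ k, 0 < l k) ∧ ∀ s : ℝ, s < 0 → ∀ᶠ k in atTop,
      ∫⁻ x, ‖fderiv ℝ (u (l k ^ 2 * s)) x‖ₑ ^ 2 ≤
        ENNReal.ofReal (K₁ / Real.sqrt (-(l k ^ 2 * s))) := by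
  -- copied from the proof of `Subthreshold.notSingular_of_subthreshold_windows`
  have hΛ : ∀ k : ℕ, (1 : ℝ) < (k : ℝ) + 2 := fun k => by
    have : (0 : ℝ) ≤ k := Nat.cast_nonneg k
    linarith
  choose τ hτ hτwin using fun k : ℕ => hwin ((k : ℝ) + 2) (hΛ k)
  refine ⟨fun k => Real.sqrt (-τ k), fun k => Real.sqrt_pos.2 (neg_pos.2 (hτ k)), fun s hs => ?_⟩
  have hl2 : ∀ k, Real.sqrt (-τ k) ^ 2 = -τ k := fun k => Real.sq_sqrt (neg_pos.2 (hτ k)).le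
  have hev : ∀ᶠ k : ℕ in atTop, -s ≤ ((k : ℝ) + 2) ^ 2 ∧ -s⁻¹ ≤ ((k : ℝ) + 2) ^ 2 := by
    have hT : Tendsto (fun k : ℕ => ((k : ℝ) + 2) ^ 2) atTop atTop :=
      (tendsto_pow_atTop two_ne_zero).comp
        (tendsto_atTop_add_const_right atTop (2 : ℝ) tendsto_natCast_atTop_atTop)
    exact (hT.eventually_ge_atTop (-s)).and (hT.eventually_ge_atTop (-s⁻¹))
  filter_upwards [hev] with k hk
  obtain ⟨h1, h2⟩ := hk
  rw [hl2 k]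
  have hτ' : 0 < -τ k := neg_pos.2 (hτ k)
  refine hτwin k (-τ k * s) ⟨by nlinarith, ?_⟩
  have hΛ2 : (0 : ℝ) < ((k : ℝ) + 2) ^ 2 := by positivity
  rw [le_div_iff₀ hΛ2]
  have hs' : 0 < -s := neg_pos.2 hs
  have h3 : 1 ≤ (-s) * ((k : ℝ) + 2) ^ 2 := by
    have := mul_le_mul_of_nonneg_left h2 hs'.le
    rwa [show (-s) * (-s⁻¹) = 1 by rw [neg_mul_neg, mul_inv_cancel₀ hs.ne]] at this
  nlinarith

/-! ### Sub-threshold windows of a singular member produce a singular member at the lower level -/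

/-- **A singular member with sub-`K₁` dissipation on long windows yields a singular member of
`𝒟_{C,K₁}`.** If `u ∈ 𝒟_{C,K}` is singular at the apex and `D_u ≤ K₁` on backward windows
`[Λ²τ, τ/Λ²]` for every `Λ > 1`, then some `W ∈ 𝒟_{C,K₁}` is singular at the apex (the orbit
limit along the windows; persistence). -/
theorem exists_singular_of_subthreshold_windows {C K K₁ : ℝ}
    {u : ℝ → EuclideanSpace ℝ (Fin 3) → EuclideanSpace ℝ (Fin 3)} (hu : IsTypeIAncientMild C u)
    (hlaw : ∀ s : ℝ, s < 0 → ∫⁻ x, ‖fderiv ℝ (u s) x‖ₑ ^ 2 ≤ ENNReal.ofReal (K / Real.sqrt (-s)))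
    (hsing : ∀ r > 0, ∀ M : ℝ, ∃ t ∈ Set.Ioo (-(r ^ 2)) (0 : ℝ),
      ∃ x ∈ Metric.ball (0 : EuclideanSpace ℝ (Fin 3)) r, M < ‖u t x‖)
    (hwin : ∀ Λ : ℝ, 1 < Λ → ∃ τ : ℝ, τ < 0 ∧ ∀ t ∈ Set.Icc (Λ ^ 2 * τ) (τ / Λ ^ 2),
      ∫⁻ x, ‖fderiv ℝ (u t) x‖ₑ ^ 2 ≤ ENNReal.ofReal (K₁ / Real.sqrt (-t))) :
    ∃ W : ℝ → EuclideanSpace ℝ (Fin 3) → EuclideanSpace ℝ (Fin 3),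
      IsTypeIAncientMild C W ∧
      (∀ s : ℝ, s < 0 → ∫⁻ x, ‖fderiv ℝ (W s) x‖ₑ ^ 2 ≤ ENNReal.ofReal (K₁ / Real.sqrt (-s))) ∧
      (∀ r > 0, ∀ M : ℝ, ∃ t ∈ Set.Ioo (-(r ^ 2)) (0 : ℝ),
        ∃ x ∈ Metric.ball (0 : EuclideanSpace ℝ (Fin 3)) r, M < ‖W t x‖) := by
  obtain ⟨l, hl, hwin'⟩ := exists_scales_of_windows hwin
  have hwin'' : ∀ s : ℝ, s < 0 → ∀ᶠ k in atTop,
      ∫⁻ x, ‖fderiv ℝ (nsRescale (l k) u s) x‖ₑ ^ 2 ≤ ENNReal.ofReal (K₁ / Real.sqrt (-s)) :=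
    fun s hs => (hwin' s hs).mono fun k hk => Subthreshold.law_nsRescale_of_law_at (hl k) hs hk
  obtain ⟨ψ, -, W, hW, hlawW, hunif, -⟩ :=
    Subthreshold.exists_orbitLimit_of_eventually_law hu hlaw l hl hwin''
  exact ⟨W, hW, hlawW, RecurrentReductionD.persistent_singularity hu hlaw hsing (fun j => l (ψ j))
    (fun j => hl _) W hunif⟩

/-! ### The critical element -/

/-- **Existence of the critical (minimal-dissipation) singular profile.** If `𝒟_{C,K}` contains a
member singular at the apex, then there is a least constant `K_c ≤ K` such that `𝒟_{C,K_c}`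
contains a singular member: some singular `W_c ∈ 𝒟_{C,K_c}` exists, and no member of `𝒟_{C,K'}`
with `K' < K_c` is singular. (`K_c = inf` of the admissible constants; a minimising sequence of
singular members subconverges by KNSS compactness across members, the limit has the law `K_c` by
Fatou and is singular by persistence across members.) -/
theorem exists_minimal_singular {C K : ℝ}
    {u : ℝ → EuclideanSpace ℝ (Fin 3) → EuclideanSpace ℝ (Fin 3)} (hu : IsTypeIAncientMild C u)
    (hlaw : ∀ s : ℝ, s < 0 → ∫⁻ x, ‖fderiv ℝ (u s) x‖ₑ ^ 2 ≤ ENNReal.ofReal (K / Real.sqrt (-s)))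
    (hsing : ∀ r > 0, ∀ M : ℝ, ∃ t ∈ Set.Ioo (-(r ^ 2)) (0 : ℝ),
      ∃ x ∈ Metric.ball (0 : EuclideanSpace ℝ (Fin 3)) r, M < ‖u t x‖) :
    ∃ Kc : ℝ, Kc ≤ K ∧
      (∃ W : ℝ → EuclideanSpace ℝ (Fin 3) → EuclideanSpace ℝ (Fin 3),
        IsTypeIAncientMild C W ∧
        (∀ s : ℝ, s < 0 → ∫⁻ x, ‖fderiv ℝ (W s) x‖ₑ ^ 2 ≤ ENNReal.ofReal (Kc / Real.sqrt (-s))) ∧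
        (∀ r > 0, ∀ M : ℝ, ∃ t ∈ Set.Ioo (-(r ^ 2)) (0 : ℝ),
          ∃ x ∈ Metric.ball (0 : EuclideanSpace ℝ (Fin 3)) r, M < ‖W t x‖)) ∧
      (∀ K' : ℝ, K' < Kc → ∀ w : ℝ → EuclideanSpace ℝ (Fin 3) → EuclideanSpace ℝ (Fin 3),
        IsTypeIAncientMild C w →
        (∀ s : ℝ, s < 0 → ∫⁻ x, ‖fderiv ℝ (w s) x‖ₑ ^ 2 ≤ ENNReal.ofReal (K' / Real.sqrt (-s))) →
        ¬ (∀ r > 0, ∀ M : ℝ, ∃ t ∈ Set.Ioo (-(r ^ 2)) (0 : ℝ),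
          ∃ x ∈ Metric.ball (0 : EuclideanSpace ℝ (Fin 3)) r, M < ‖w t x‖)) := by
  -- the set of admissible constants
  set S : Set ℝ := {K' | ∃ w : ℝ → EuclideanSpace ℝ (Fin 3) → EuclideanSpace ℝ (Fin 3),
    IsTypeIAncientMild C w ∧
    (∀ s : ℝ, s < 0 → ∫⁻ x, ‖fderiv ℝ (w s) x‖ₑ ^ 2 ≤ ENNReal.ofReal (K' / Real.sqrt (-s))) ∧
    (∀ r > 0, ∀ M : ℝ, ∃ t ∈ Set.Ioo (-(r ^ 2)) (0 : ℝ),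
      ∃ x ∈ Metric.ball (0 : EuclideanSpace ℝ (Fin 3)) r, M < ‖w t x‖)} with hS
  have hKS : K ∈ S := ⟨u, hu, hlaw, hsing⟩
  have hne : S.Nonempty := ⟨K, hKS⟩
  -- bounded below by the gap constant
  obtain ⟨K₀, hK₀, hgap⟩ := Birth.stub_smallDissipationGap
  have hbdd : BddBelow S := by
    refine ⟨K₀, fun K' hK' => ?_⟩
    obtain ⟨w, hw, hlw, hsw⟩ := hK'
    by_contra hlt
    push Not at hlt
    have hz := hgap C K' w hlt.le hw hlw
    obtain ⟨t, ht, x, -, hM⟩ := hsw 1 one_pos 0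
    rw [hz t ht.2 x, norm_zero] at hM
    exact lt_irrefl 0 hM
  set Kc : ℝ := sInf S with hKc
  refine ⟨Kc, csInf_le hbdd hKS, ?_, fun K' hK' w hw hlw hsw => ?_⟩
  · -- attainment: a minimising sequence of singular members
    have hglb : IsGLB S Kc := isGLB_csInf hne hbdd
    obtain ⟨Kk, hanti, -, htend, hmem⟩ := hglb.exists_seq_antitone_tendsto hne
    have hmem' : ∀ n, ∃ w : ℝ → EuclideanSpace ℝ (Fin 3) → EuclideanSpace ℝ (Fin 3),
        IsTypeIAncientMild C w ∧
        (∀ s : ℝ, s < 0 → ∫⁻ x, ‖fderiv ℝ (w s) x‖ₑ ^ 2 ≤ ENNReal.ofReal (Kk n / Real.sqrt (-s))) ∧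
        (∀ r > 0, ∀ M : ℝ, ∃ t ∈ Set.Ioo (-(r ^ 2)) (0 : ℝ),
          ∃ x ∈ Metric.ball (0 : EuclideanSpace ℝ (Fin 3)) r, M < ‖w t x‖) := fun n => by
      have h := hmem n
      rw [hS] at h
      exact h
    choose w hw hlw hsw using hmem'
    -- common law constant `Kk 0` along the sequence
    have hlw0 : ∀ k, ∀ s : ℝ, s < 0 →
        ∫⁻ x, ‖fderiv ℝ (w k s) x‖ₑ ^ 2 ≤ ENNReal.ofReal (Kk 0 / Real.sqrt (-s)) :=
      fun k => law_mono (hanti (Nat.zero_le k)) (hlw k)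
    obtain ⟨ψ, hψ, W, hW, hunif, -, hgrad⟩ := Compactness.seqLimit hw
    have hψt : Tendsto ψ atTop atTop := hψ.tendsto_atTop
    have hlawW : ∀ s : ℝ, s < 0 →
        ∫⁻ x, ‖fderiv ℝ (W s) x‖ₑ ^ 2 ≤ ENNReal.ofReal (Kc / Real.sqrt (-s)) :=
      Compactness.law_of_seqLimit hψt hlw (fun ε hε => (tendsto_order.1 htend).2 (Kc + ε)
        (lt_add_of_pos_right _ hε) |>.mono fun k hk => hk.le) hgrad
    have hsingW := Compactness.persistent_singularity_seq (fun j => hw (ψ j)) (fun j => hlw0 (ψ j))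
      (fun j => hsw (ψ j)) hW hunif
    exact ⟨W, hW, hlawW, hsingW⟩
  · -- minimality
    have hmem : K' ∈ S := ⟨w, hw, hlw, hsw⟩
    exact absurd (csInf_le hbdd hmem) (not_le.2 hK')

/-- **The critical constant exceeds the gap constant.** With `K₀ > 0` the absolute constant of
`stub_smallDissipationGap`: a singular member of `𝒟_{C,K_c}` forces `K₀ < K_c`. -/
theorem criticalConstant_gt_gap :
    ∃ K₀ : ℝ, 0 < K₀ ∧ ∀ (C Kc : ℝ)
      (W : ℝ → EuclideanSpace ℝ (Fin 3) → EuclideanSpace ℝ (Fin 3)), IsTypeIAncientMild C W →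
      (∀ s : ℝ, s < 0 → ∫⁻ x, ‖fderiv ℝ (W s) x‖ₑ ^ 2 ≤ ENNReal.ofReal (Kc / Real.sqrt (-s))) →
      (∀ r > 0, ∀ M : ℝ, ∃ t ∈ Set.Ioo (-(r ^ 2)) (0 : ℝ),
        ∃ x ∈ Metric.ball (0 : EuclideanSpace ℝ (Fin 3)) r, M < ‖W t x‖) → K₀ < Kc := by
  obtain ⟨K₀, hK₀, hgap⟩ := Birth.stub_smallDissipationGap
  refine ⟨K₀, hK₀, fun C Kc W hW hlawW hsing => ?_⟩
  by_contra hle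
  push Not at hle
  have hz := hgap C Kc W hle hW hlawW
  obtain ⟨t, ht, x, -, hM⟩ := hsing 1 one_pos 0
  rw [hz t ht.2 x, norm_zero] at hM
  exact lt_irrefl 0 hM

/-! ### Near-saturation of the dissipation of a minimal singular profile -/

/-- **The critical element nearly saturates its dissipation bound on a relatively dense set of
log-times.** Let `K_c` be minimal (no member of `𝒟_{C,K'}`, `K' < K_c`, is singular) and let
`W ∈ 𝒟_{C,K_c}` be singular at the apex. Then for every `ε > 0` there is `Λ > 1` such that every
backward window `[Λ²τ, τ/Λ²]` (`τ < 0`) contains a time `t` with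
`(K_c − ε)/√(−t) < ∫ ‖∇W(t)‖²`, i.e. `D_W(t) > K_c − ε` (while `D_W ≤ K_c` always). Otherwise the
windows with `D_W ≤ K_c − ε` would produce a singular member of `𝒟_{C,K_c−ε}`
(`exists_singular_of_subthreshold_windows`), contradicting minimality. -/
theorem dissipation_nearMax_of_minimal {C Kc : ℝ}
    (hmin : ∀ K' : ℝ, K' < Kc → ∀ w : ℝ → EuclideanSpace ℝ (Fin 3) → EuclideanSpace ℝ (Fin 3),
      IsTypeIAncientMild C w →
      (∀ s : ℝ, s < 0 → ∫⁻ x, ‖fderiv ℝ (w s) x‖ₑ ^ 2 ≤ ENNReal.ofReal (K' / Real.sqrt (-s))) →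
      ¬ (∀ r > 0, ∀ M : ℝ, ∃ t ∈ Set.Ioo (-(r ^ 2)) (0 : ℝ),
        ∃ x ∈ Metric.ball (0 : EuclideanSpace ℝ (Fin 3)) r, M < ‖w t x‖))
    {W : ℝ → EuclideanSpace ℝ (Fin 3) → EuclideanSpace ℝ (Fin 3)} (hW : IsTypeIAncientMild C W)
    (hlawW : ∀ s : ℝ, s < 0 → ∫⁻ x, ‖fderiv ℝ (W s) x‖ₑ ^ 2 ≤ ENNReal.ofReal (Kc / Real.sqrt (-s)))
    (hsingW : ∀ r > 0, ∀ M : ℝ, ∃ t ∈ Set.Ioo (-(r ^ 2)) (0 : ℝ),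
      ∃ x ∈ Metric.ball (0 : EuclideanSpace ℝ (Fin 3)) r, M < ‖W t x‖) :
    ∀ ε : ℝ, 0 < ε → ∃ Λ : ℝ, 1 < Λ ∧ ∀ τ : ℝ, τ < 0 → ∃ t ∈ Set.Icc (Λ ^ 2 * τ) (τ / Λ ^ 2),
      ENNReal.ofReal ((Kc - ε) / Real.sqrt (-t)) < ∫⁻ x, ‖fderiv ℝ (W t) x‖ₑ ^ 2 := by
  intro ε hε
  by_contra hcon
  push Not at hcon
  obtain ⟨W', hW', hlawW', hsingW'⟩ := exists_singular_of_subthreshold_windows hW hlawW hsingW hcon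
  exact hmin (Kc - ε) (by linarith) W' hW' hlawW' hsingW'

/-- **The critical-element package.** There is an absolute `K₀ > 0` such that: whenever some
`𝒟_{C,K}` contains a member singular at the apex (i.e. `FiniteDissipationLiouville` fails at the
constant `C`), there are `K_c` with `K₀ < K_c ≤ K` and a singular `W_c ∈ 𝒟_{C,K_c}` such that
(i) no member of `𝒟_{C,K'}`, `K' < K_c`, is singular, and (ii) for every `ε > 0` the dimensionless
dissipation of `W_c` exceeds `K_c − ε` somewhere in every sufficiently long backward log-window. -/
theorem criticalElement :
    ∃ K₀ : ℝ, 0 < K₀ ∧ ∀ (C K : ℝ)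
      (u : ℝ → EuclideanSpace ℝ (Fin 3) → EuclideanSpace ℝ (Fin 3)), IsTypeIAncientMild C u →
      (∀ s : ℝ, s < 0 → ∫⁻ x, ‖fderiv ℝ (u s) x‖ₑ ^ 2 ≤ ENNReal.ofReal (K / Real.sqrt (-s))) →
      (∀ r > 0, ∀ M : ℝ, ∃ t ∈ Set.Ioo (-(r ^ 2)) (0 : ℝ),
        ∃ x ∈ Metric.ball (0 : EuclideanSpace ℝ (Fin 3)) r, M < ‖u t x‖) →
      ∃ (Kc : ℝ) (W : ℝ → EuclideanSpace ℝ (Fin 3) → EuclideanSpace ℝ (Fin 3)),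
        K₀ < Kc ∧ Kc ≤ K ∧ IsTypeIAncientMild C W ∧
        (∀ s : ℝ, s < 0 → ∫⁻ x, ‖fderiv ℝ (W s) x‖ₑ ^ 2 ≤ ENNReal.ofReal (Kc / Real.sqrt (-s))) ∧
        (∀ r > 0, ∀ M : ℝ, ∃ t ∈ Set.Ioo (-(r ^ 2)) (0 : ℝ),
          ∃ x ∈ Metric.ball (0 : EuclideanSpace ℝ (Fin 3)) r, M < ‖W t x‖) ∧
        (∀ K' : ℝ, K' < Kc → ∀ w : ℝ → EuclideanSpace ℝ (Fin 3) → EuclideanSpace ℝ (Fin 3),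
          IsTypeIAncientMild C w →
          (∀ s : ℝ, s < 0 → ∫⁻ x, ‖fderiv ℝ (w s) x‖ₑ ^ 2 ≤ ENNReal.ofReal (K' / Real.sqrt (-s))) →
          ¬ (∀ r > 0, ∀ M : ℝ, ∃ t ∈ Set.Ioo (-(r ^ 2)) (0 : ℝ),
            ∃ x ∈ Metric.ball (0 : EuclideanSpace ℝ (Fin 3)) r, M < ‖w t x‖)) ∧
        (∀ ε : ℝ, 0 < ε → ∃ Λ : ℝ, 1 < Λ ∧ ∀ τ : ℝ, τ < 0 →
          ∃ t ∈ Set.Icc (Λ ^ 2 * τ) (τ / Λ ^ 2),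
            ENNReal.ofReal ((Kc - ε) / Real.sqrt (-t)) < ∫⁻ x, ‖fderiv ℝ (W t) x‖ₑ ^ 2) := by
  obtain ⟨K₀, hK₀, hgt⟩ := criticalConstant_gt_gap
  refine ⟨K₀, hK₀, fun C K u hu hlaw hsing => ?_⟩
  obtain ⟨Kc, hKcK, ⟨W, hW, hlawW, hsingW⟩, hmin⟩ := exists_minimal_singular hu hlaw hsing
  exact ⟨Kc, W, hgt C Kc W hW hlawW hsingW, hKcK, hW, hlawW, hsingW, hmin,
    dissipation_nearMax_of_minimal hmin hW hlawW hsingW⟩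

end Summit.NavierStokesRegularity.NavierStokesRegularity.Theorems.FiniteDissipationLiouville.CriticalElement

end
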